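import Literature.NumberTheory.EllipticCurves.RankinSymmSquareGL2Bound
import Literature.NumberTheory.EllipticCurves.RankinSymmSquareTwistComparison
import HarnessLib

/-!
# Murty's bound `(f, f) ≫ N^{1−ε}` from the PAIR data alone (member side of the Hoffstein–Lockhart
datum discharged)

Topic `NumberTheory/EllipticCurves`; namespace `Literature.NumberTheory.EllipticCurves.ModularForms`.
A proofs-only file (theorems only; no definition, no named fact, D-0026). The named fact
`murty_petersson_newform_lower_bound` (`NewformPeterssonSize`, Murty 1999 (3) ⇐ Hoffstein–Lockhart
1994, Thm. 0.1) was reduced in `NewformPeterssonSizeSiegelReductionProofs` to the existence of a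
`SiegelPairFamilyData` (`LFunctions/SiegelTheoremPairAbstract`, Siegel's theorem with external pair
functions) on the elliptic newforms. Here EVERY MEMBER-SIDE FIELD of that datum is discharged for
the symmetric-square family `L i = L_{f_i}` (`symmSqL`, the continued `ζ(2s)L(|a|², s+1)/ζ(s)` of
`RankinSymmSquareGL2Fields`), `Z = (s − 1)ζ(s)` (Mathlib `riemannZeta₁`), `Q i = N_i`, on the disc
`|s − 2| ≤ 1 + r` of a Siegel radius `r` (`exists_siegel_radius`):

* `Z`: entire, bounded on the disc (compactness), real on reals (`riemannZeta₁_ofReal_im_eq_zero`,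
  Schwarz reflection), `Z(1) = 1 > 0`, `Z(σ) = (σ − 1)ζ(σ) > 0` on `(1, 2]`
  (`riemannZeta₁_ofReal_re_pos`, `ζ(σ) ≥ 1`);
* `L i`: holomorphic on `ball 2 (1 + 2r)` (`differentiableOn_symmSqL_ball`), real on the real
  diameter (`symmSqL_ofReal_im_eq_zero`), `L_i(1) = 8π³(f,f)/[SL₂(ℤ):Γ₀(N)] > 0` (`symmSqL_one_re_pos`,
  `IsNewformOf.peterssonProduct_re_pos`), `Z L_i = (s − 1)·(Dirichlet series ≥ 0, a(1) = 1)`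
  (`symmSqL_coeff₁`, `a₁(f) = 1`), and the weak polynomial bound
  `‖L_i(s)‖ ≤ B N_i¹⁵ max(1, L_i(1))` (`exists_norm_symmSqL_le`, from the uniform Rankin–Selberg
  bound — no functional equation);
* the comparison `L_i(1) ≤ symmSqLOne f_i` (`symmSqL_one_re_le_symmSqLOne`:
  `[SL₂(ℤ):Γ₀(N)] ≥ N` and `symmSqLOne f = 8π³(f,f)/N`, `symmSqLOne_eq`) feeding `hL`, and `Q i = N_i`
  feeding `hQ` of `murty_petersson_newform_lower_bound_of_siegelPairFamilyData_univ`.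

**Main results** `murty_petersson_newform_lower_bound_of_pairData_indexed` (a sub-family `idx`, with
the rest bounded directly), `murty_petersson_newform_lower_bound_of_pairData` (the whole family) and
`murty_petersson_newform_lower_bound_of_pairData_nonCM` (non-CM members, `Equiv = TwistEquiv` whose
`equiv_case` is the theorem `twistEquiv_equiv_case` of `RankinSymmSquareTwistComparison`, CM members
bounded directly): the fact follows from the PAIR
data alone — an equivalence-like `Equiv` on elliptic newforms and pair functions `P i j`
(model: `L(s, Sym² f_i × Sym² f_j)`, Gelbart–Jacquet lifts and the `GL₃ × GL₃` Rankin–Selberg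
convolution) that are, off `Equiv`, holomorphic on `|s − 2| < 3/2` with a polynomial bound on
`|s − 2| ≤ 3/2`, make `(s − 1)ζ(s) L_{f_i}(s) L_{f_j}(s) P_{ij}(s)` a Dirichlet series with
non-negative coefficients and `a(1) = 1` (local positivity: `LFunctions/RankinSelbergLocalPositivity`),
satisfy `|P_{ij}(1)| ≪_δ (N_iN_j)^δ`; and, on `Equiv` (model: quadratic twists / equal CM field),
`L_{f_i}(1) ≫_δ (N_iN_j)^{−δ} L_{f_j}(1)`. These remaining inputs are exactly the `GL₃` part of
Hoffstein–Lockhart's proof (their §1 with Bump–Ginzburg / Jacquet–Piatetski-Shapiro–Shalika), for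
which the tree has no carrier yet.

## References

* J. Hoffstein, P. Lockhart, *Coefficients of Maass forms and the Siegel zero*, Ann. of Math. 140
  (1994), 161–181, Thm. 0.1 and §1. [cite: HoffsteinLockhart1994, Thm. 0.1]
* M. R. Murty, *Bounds for congruence primes*, Proc. Sympos. Pure Math. 66.1 (1999), §2, (3).
  [cite: MurtyCongruencePrimes1999, §2 (3)]
* H. L. Montgomery, R. C. Vaughan, *Multiplicative Number Theory I* (2007), §11.2, Thm. 11.14
  (the scheme of Siegel's theorem). [cite: MontgomeryVaughan2007, §11.2 Theorem 11.14]

## Mathlib / tree search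

Tree: `murty_petersson_newform_lower_bound_of_siegelPairFamilyData_univ`, `EllipticNewformIndex`
(`NewformPeterssonSizeSiegelReductionProofs`); `SiegelPairFamilyData` (v3, weak `norm_L_le`);
`symmSqL`, `exists_siegel_radius`, `differentiableOn_symmSqL_ball`, `symmSqL_coeff₁`, `symmSqL_one`,
`symmSqL_one_re_pos`, `symmSqL_ofReal_im_eq_zero`, `riemannZeta_ofReal_im_eq_zero`,
`eqOn_of_differentiableOn_of_eq_on_Ioo` (`RankinSymmSquareGL2Fields`); `exists_norm_symmSqL_le`
(`RankinSymmSquareGL2Bound`); `le_gamma0Index` (`NewformPeterssonSizeRankinSelbergProofs`); `symmSqLOne_eq`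
(`CuspFormSymmSquareLSeries`);
`IsNewformOf.peterssonProduct_re_pos` (`NewformPeterssonSizeProofs`); `TwistEquiv`,
`twistEquiv_equiv_case` (`RankinSymmSquareTwistComparison`). Mathlib: `riemannZeta₁`,
`differentiable_riemannZeta₁`, `riemannZeta₁_one`, `riemannZeta_eq_inv_sub_mul`,
`zeta_eq_tsum_one_div_nat_cpow`, `IsCompact.exists_bound_of_continuousOn`.
-/

noncomputable section

open scoped Real Topology
open Set Filter Metric Complex CongruenceSubgroup
open scoped ComplexConjugate ComplexOrder
open Literature.NumberTheory.LFunctions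

namespace Literature.NumberTheory.EllipticCurves.ModularForms

/-! ### `Z = (s − 1)ζ(s)`: reality and positivity on the real line -/

section Zeta

/-- `ζ(σ) ≥ 1` for real `σ > 1` (the series `Σ n^{−σ}` with its first term). [folklore] -/
theorem one_le_re_riemannZeta_ofReal'' {σ : ℝ} (hσ : 1 < σ) : 1 ≤ (riemannZeta σ).re := by
  rw [zeta_eq_tsum_one_div_nat_cpow (by simpa using hσ)]
  have h : (∑' n : ℕ, 1 / (n : ℂ) ^ (σ : ℂ)) = ((∑' n : ℕ, 1 / (n : ℝ) ^ σ : ℝ) : ℂ) := by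
    rw [Complex.ofReal_tsum]
    refine tsum_congr fun n ↦ ?_
    rw [← Complex.ofReal_natCast, ← Complex.ofReal_cpow (Nat.cast_nonneg n)]
    push_cast; rfl
  rw [h, Complex.ofReal_re]
  have hsum : Summable fun n : ℕ ↦ 1 / (n : ℝ) ^ σ := Real.summable_one_div_nat_rpow.mpr hσ
  have h1 := hsum.le_tsum 1 fun n _ ↦ by positivity
  simpa using h1

/-- `(σ − 1)ζ(σ) = riemannZeta₁ σ` is real for real `σ > 1`. [folklore] -/
theorem riemannZeta₁_ofReal_im_eq_zero_of_one_lt {σ : ℝ} (hσ : 1 < σ) : (riemannZeta₁ σ).im = 0 := by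
  have hs1 : (σ : ℂ) ≠ 1 := by
    intro h; have := congrArg Complex.re h; simp at this; linarith
  have hsub : (σ : ℂ) - 1 ≠ 0 := sub_ne_zero.mpr hs1
  have hζ₁ : riemannZeta₁ σ = ((σ : ℂ) - 1) * riemannZeta σ := by
    rw [riemannZeta_eq_inv_sub_mul hs1, ← mul_assoc, mul_inv_cancel₀ hsub, one_mul]
  rw [hζ₁, show ((σ : ℂ) - 1) = ((σ - 1 : ℝ) : ℂ) by push_cast; ring, Complex.im_ofReal_mul,
    riemannZeta_ofReal_im_eq_zero hσ, mul_zero]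

/-- **`riemannZeta₁` is real on the whole real line** (Schwarz reflection: `s ↦ conj Z(s̄)` is entire
and agrees with `Z` on `(1, 3)`). [folklore] -/
theorem riemannZeta₁_ofReal_im_eq_zero (σ : ℝ) : (riemannZeta₁ σ).im = 0 := by
  set g' : ℂ → ℂ := fun s ↦ conj (riemannZeta₁ (conj s)) with hg'
  have hg'd : DifferentiableOn ℂ g' univ := by
    intro z _
    have hd : DifferentiableAt ℂ riemannZeta₁ (conj z) := differentiable_riemannZeta₁ _
    exact (differentiableAt_conj_conj_iff.mpr hd).differentiableWithinAt
  have heq : ∀ τ : ℝ, 1 < τ → τ < 3 → g' τ = riemannZeta₁ τ := by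
    intro τ h1 _
    simp only [hg', Complex.conj_ofReal]
    exact Complex.conj_eq_iff_im.mpr (riemannZeta₁_ofReal_im_eq_zero_of_one_lt h1)
  have hEq := eqOn_of_differentiableOn_of_eq_on_Ioo isOpen_univ isPreconnected_univ hg'd
    differentiable_riemannZeta₁.differentiableOn (by norm_num : (1 : ℝ) < 3) (fun _ _ _ ↦ mem_univ _) heq
  have h := hEq (mem_univ (σ : ℂ))
  simp only [hg', Complex.conj_ofReal] at h
  exact Complex.conj_eq_iff_im.mp h

/-- **`riemannZeta₁ σ = (σ − 1)ζ(σ) > 0` for real `σ > 1`** (`ζ(σ) ≥ 1`). [folklore] -/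
theorem riemannZeta₁_ofReal_re_pos {σ : ℝ} (hσ : 1 < σ) : 0 < (riemannZeta₁ σ).re := by
  have hs1 : (σ : ℂ) ≠ 1 := by
    intro h; have := congrArg Complex.re h; simp at this; linarith
  have hsub : (σ : ℂ) - 1 ≠ 0 := sub_ne_zero.mpr hs1
  have hζ₁ : riemannZeta₁ σ = ((σ : ℂ) - 1) * riemannZeta σ := by
    rw [riemannZeta_eq_inv_sub_mul hs1, ← mul_assoc, mul_inv_cancel₀ hsub, one_mul]
  rw [hζ₁, show ((σ : ℂ) - 1) = ((σ - 1 : ℝ) : ℂ) by push_cast; ring, Complex.re_ofReal_mul]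
  exact mul_pos (by linarith) (lt_of_lt_of_le one_pos (one_le_re_riemannZeta_ofReal'' hσ))

end Zeta

/-! ### `L_f(1) ≤ symmSqLOne f` -/

section Index

/-- **`Re L_f(1) ≤ symmSqLOne f`**: `L_f(1) = 8π³ Re(f,f)/[SL₂(ℤ):Γ₀(N)]` (`symmSqL_one`),
`symmSqLOne f = 8π³ Re(f,f)/N` (`symmSqLOne_eq`) and `[SL₂(ℤ):Γ₀(N)] ≥ N`. [folklore] -/
theorem symmSqL_one_re_le_symmSqLOne {N : ℕ} [NeZero N] (f : CuspForm (Gamma0 N) 2) :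
    (symmSqL N f 1).re ≤ symmSqLOne f := by
  have hN0 : N ≠ 0 := NeZero.ne N
  have hN : (0 : ℝ) < N := by exact_mod_cast Nat.pos_of_ne_zero hN0
  have hidx : (N : ℝ) ≤ gamma0Index N := by exact_mod_cast le_gamma0Index hN0
  have hV0 := re_peterssonProduct_self_nonneg f
  rw [symmSqL_one, Complex.ofReal_re, symmSqLOne_eq]
  exact div_le_div_of_nonneg_left (by positivity) hN hidx

end Index

/-! ### The reduction to pair data -/

section PairReduction

/-- **Murty's bound from the pair data alone, indexed form.** Let `idx : ι → EllipticNewformIndex`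
pick out a sub-family of elliptic newforms (model: the non-CM ones), `Equiv` a relation on `ι` and
`P i j : ℂ → ℂ` pair functions (model: `L(s, Sym² f_i × Sym² f_j)`) such that, OFF `Equiv`,
`P i j` is holomorphic on `|s − 2| < 3/2`, `‖P i j s‖ ≤ B₂ (N_iN_j)^{κ₂}` on `|s − 2| ≤ 3/2`,
`(s − 1)ζ(s)·L_{f_i}(s)L_{f_j}(s)P_{ij}(s) = (s − 1)Σ a(n)n^{−s}` on `Re s > 1` with `a ≥ 0`,
`a(1) = 1`, and `|P_{ij}(1)| ≤ T(δ)(N_iN_j)^δ` for every `δ > 0`; ON `Equiv`,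
`L_{f_i}(1) ≥ D(δ)(N_iN_j)^{−δ} L_{f_j}(1)` for every `δ > 0` (here `L_f = symmSqL N f`); and suppose
the newforms outside the sub-family satisfy `symmSqLOne f ≥ c(ε)N^{−ε}` directly. Then
`(f, f) ≥ c(ε) N^{1−ε}` for the newforms of all elliptic curves over `ℚ`
(`murty_petersson_newform_lower_bound`). All member-side inputs of Siegel's argument (holomorphy,
reality, positivity and non-negativity of coefficients, the weak polynomial bound) are theorems of the
tree; the constant is ineffective. [cite: HoffsteinLockhart1994, Thm. 0.1]
[cite: MurtyCongruencePrimes1999, §2 (3)] [cite: MontgomeryVaughan2007, §11.2 Theorem 11.14] -/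
theorem murty_petersson_newform_lower_bound_of_pairData_indexed {ι : Type*}
    (idx : ι → EllipticNewformIndex) (Equiv : ι → ι → Prop) (P : ι → ι → ℂ → ℂ)
    (hPd : ∀ i j, ¬ Equiv i j → DifferentiableOn ℂ (P i j) (ball (2 : ℂ) (3 / 2)))
    {B₂ κ₂ : ℝ} (hB₂ : 0 ≤ B₂) (hκ₂ : 0 ≤ κ₂)
    (hPle : ∀ i j, ¬ Equiv i j → ∀ s ∈ closedBall (2 : ℂ) (3 / 2),
      ‖P i j s‖ ≤ B₂ * (((idx i).N : ℝ) * (idx j).N) ^ κ₂)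
    (hcoeff₃ : ∀ i j, ¬ Equiv i j → ∃ a : ℕ → ℂ, 0 ≤ a ∧ a 1 = 1 ∧
      (∀ s : ℂ, 1 < s.re → LSeriesSummable a s) ∧
      ∀ s : ℂ, 1 < s.re →
        riemannZeta₁ s * (symmSqL (idx i).N (idx i).f s * symmSqL (idx j).N (idx j).f s * P i j s) =
          (s - 1) * LSeries a s)
    (hP1 : ∀ δ : ℝ, 0 < δ → ∃ T : ℝ, ∀ i j, ¬ Equiv i j →
      ‖P i j 1‖ ≤ T * (((idx i).N : ℝ) * (idx j).N) ^ δ)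
    (hequiv : ∀ δ : ℝ, 0 < δ → ∃ D : ℝ, 0 < D ∧ ∀ i j, Equiv i j →
      D * (((idx i).N : ℝ) * (idx j).N) ^ (-δ) * (symmSqL (idx j).N (idx j).f 1).re ≤
        (symmSqL (idx i).N (idx i).f 1).re)
    (hrest : ∀ ε : ℝ, 0 < ε → ∃ c : ℝ, 0 < c ∧ ∀ j : EllipticNewformIndex, j ∉ Set.range idx →
      c * (j.N : ℝ) ^ (-ε) ≤ symmSqLOne j.f) :
    murty_petersson_newform_lower_bound := by
  -- the Siegel radius and the uniform member bound
  obtain ⟨r, hr0, hr4, hr⟩ := exists_siegel_radius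
  obtain ⟨B, hB, hBle⟩ := exists_norm_symmSqL_le hr0 hr4 hr
  obtain ⟨MZ, hMZ⟩ := (isCompact_closedBall (2 : ℂ) (1 + r)).exists_bound_of_continuousOn
    differentiable_riemannZeta₁.continuous.continuousOn
  have hsub₁ : closedBall (2 : ℂ) (1 + r) ⊆ ball (2 : ℂ) (1 + 2 * r) :=
    closedBall_subset_ball (by linarith)
  have hsub₂ : ball (2 : ℂ) (1 + 2 * r) ⊆ ball (2 : ℂ) (3 / 2) := ball_subset_ball (by linarith)
  have hsub₃ : closedBall (2 : ℂ) (1 + r) ⊆ closedBall (2 : ℂ) (3 / 2) :=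
    closedBall_subset_closedBall (by linarith)
  -- `a₁(f) = 1` and `(f, f) > 0` for the members
  have ha1 : ∀ k : EllipticNewformIndex, cuspCoeff k.f 1 = 1 := fun k ↦ k.isNewformOf.1.2.2
  have hpos : ∀ k : EllipticNewformIndex, 0 < (symmSqL k.N k.f 1).re ∧ (symmSqL k.N k.f 1).im = 0 :=
    fun k ↦ symmSqL_one_re_pos k.f k.isNewformOf.peterssonProduct_re_pos
  -- the datum
  let D : SiegelPairFamilyData ι :=
    { R := 1 + r
      one_lt_R := by linarith
      R_le := by linarith
      U := ball (2 : ℂ) (1 + 2 * r)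
      isOpen_U := isOpen_ball
      closedBall_subset := hsub₁
      Z := riemannZeta₁
      differentiableOn_Z := differentiable_riemannZeta₁.differentiableOn
      MZ := MZ
      norm_Z_le := hMZ
      Z_im := fun σ _ ↦ riemannZeta₁_ofReal_im_eq_zero σ
      Z_one_pos := by rw [riemannZeta₁_one, Complex.one_re]; exact one_pos
      Z_pos := fun σ h1 _ ↦ riemannZeta₁_ofReal_re_pos h1
      Q := fun i ↦ ((idx i).N : ℝ)
      one_le_Q := fun i ↦ by exact_mod_cast Nat.one_le_iff_ne_zero.mpr (NeZero.ne (idx i).N)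
      L := fun i ↦ symmSqL (idx i).N (idx i).f
      differentiableOn_L := fun i ↦ differentiableOn_symmSqL_ball (idx i).f hr
      B := B
      κ := 15
      B_nonneg := hB.le
      κ_nonneg := by norm_num
      norm_L_le := fun i s hs ↦ by
        have h := hBle (idx i).N (idx i).f s hs
        rwa [show (((idx i).N : ℝ) ^ 15 : ℝ) = ((idx i).N : ℝ) ^ (15 : ℝ) by norm_cast] at h
      L_im := fun i σ hσ ↦ symmSqL_ofReal_im_eq_zero (idx i).f hr0.le hr (hsub₁ hσ)
      L_one_ne := fun i h ↦ by
        have := (hpos (idx i)).1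
        rw [h, Complex.zero_re] at this
        exact lt_irrefl _ this
      coeff₁ := fun i ↦ symmSqL_coeff₁ (idx i).f (ha1 (idx i))
      Equiv := Equiv
      P := P
      differentiableOn_P := fun i j hij ↦ (hPd i j hij).mono hsub₂
      B₂ := B₂
      κ₂ := κ₂
      B₂_nonneg := hB₂
      κ₂_nonneg := hκ₂
      norm_P_le := fun i j hij s hs ↦ hPle i j hij s (hsub₃ hs)
      coeff₃ := hcoeff₃
      P_one_le := hP1
      equiv_case := hequiv }
  refine murty_petersson_newform_lower_bound_of_siegelPairFamilyData D idx (A := 1) (k := 1) one_pos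
    zero_le_one (fun j ↦ by simp [D]) (fun δ hδ ↦ ⟨1, one_pos, fun j ↦ ?_⟩) hrest
  have hN1 : (1 : ℝ) ≤ (idx j).N := by exact_mod_cast Nat.one_le_iff_ne_zero.mpr (NeZero.ne (idx j).N)
  have hNδ : (1 : ℝ) ≤ ((idx j).N : ℝ) ^ δ := Real.one_le_rpow hN1 hδ.le
  have h0 : 0 ≤ symmSqLOne (idx j).f :=
    (hpos (idx j)).1.le.trans (symmSqL_one_re_le_symmSqLOne (idx j).f)
  calc (D.L j 1).re = (symmSqL (idx j).N (idx j).f 1).re := rfl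
    _ ≤ symmSqLOne (idx j).f := symmSqL_one_re_le_symmSqLOne (idx j).f
    _ = 1 * 1 * symmSqLOne (idx j).f := by ring
    _ ≤ 1 * ((idx j).N : ℝ) ^ δ * symmSqLOne (idx j).f := by gcongr

/-- **Murty's bound from the pair data alone** (the whole family of elliptic newforms, arbitrary
`Equiv`): as `murty_petersson_newform_lower_bound_of_pairData_indexed` with `idx = id` (no rest
term). [cite: HoffsteinLockhart1994, Thm. 0.1] [cite: MurtyCongruencePrimes1999, §2 (3)] -/
theorem murty_petersson_newform_lower_bound_of_pairData
    (Equiv : EllipticNewformIndex → EllipticNewformIndex → Prop)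
    (P : EllipticNewformIndex → EllipticNewformIndex → ℂ → ℂ)
    (hPd : ∀ i j, ¬ Equiv i j → DifferentiableOn ℂ (P i j) (ball (2 : ℂ) (3 / 2)))
    {B₂ κ₂ : ℝ} (hB₂ : 0 ≤ B₂) (hκ₂ : 0 ≤ κ₂)
    (hPle : ∀ i j, ¬ Equiv i j → ∀ s ∈ closedBall (2 : ℂ) (3 / 2),
      ‖P i j s‖ ≤ B₂ * ((i.N : ℝ) * j.N) ^ κ₂)
    (hcoeff₃ : ∀ i j, ¬ Equiv i j → ∃ a : ℕ → ℂ, 0 ≤ a ∧ a 1 = 1 ∧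
      (∀ s : ℂ, 1 < s.re → LSeriesSummable a s) ∧
      ∀ s : ℂ, 1 < s.re →
        riemannZeta₁ s * (symmSqL i.N i.f s * symmSqL j.N j.f s * P i j s) = (s - 1) * LSeries a s)
    (hP1 : ∀ δ : ℝ, 0 < δ → ∃ T : ℝ, ∀ i j, ¬ Equiv i j → ‖P i j 1‖ ≤ T * ((i.N : ℝ) * j.N) ^ δ)
    (hequiv : ∀ δ : ℝ, 0 < δ → ∃ D : ℝ, 0 < D ∧ ∀ i j, Equiv i j →
      D * ((i.N : ℝ) * j.N) ^ (-δ) * (symmSqL j.N j.f 1).re ≤ (symmSqL i.N i.f 1).re) :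
    murty_petersson_newform_lower_bound :=
  murty_petersson_newform_lower_bound_of_pairData_indexed id Equiv P hPd hB₂ hκ₂ hPle hcoeff₃ hP1 hequiv
    fun _ _ ↦ ⟨1, one_pos, fun j hj ↦ (hj ⟨j, rfl⟩).elim⟩

/-- **Murty's bound from the GL₃ pair data for the non-CM, non-twist-equivalent pairs, plus the CM
forms directly.** With a predicate `CM` on elliptic newforms (model: complex multiplication), suppose
(1) the CM newforms satisfy `symmSqLOne f ≥ c(ε) N^{−ε}` (model: `L(1, χ_K)L(1, ψ²) ≫ N^{−ε}`,
Hecke characters of the finitely many CM fields), and (2) for the NON-CM pairs `i, j` that are NOT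
`TwistEquiv` (`|a_p(f_i)| ≠ |a_p(f_j)|` for some good prime), pair functions `P i j` as in
`murty_petersson_newform_lower_bound_of_pairData_indexed` (model: `L(s, Sym² f_i × Sym² f_j)`, entire
since the Gelbart–Jacquet lifts are cuspidal and non-isomorphic). Then
`murty_petersson_newform_lower_bound` holds: the twist-equivalent case `equiv_case` is the theorem
`twistEquiv_equiv_case` of `RankinSymmSquareTwistComparison`.
[cite: HoffsteinLockhart1994, Thm. 0.1] [cite: MurtyCongruencePrimes1999, §2 (3)] -/
theorem murty_petersson_newform_lower_bound_of_pairData_nonCM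
    (CM : EllipticNewformIndex → Prop)
    (hCM : ∀ ε : ℝ, 0 < ε → ∃ c : ℝ, 0 < c ∧ ∀ j : EllipticNewformIndex, CM j →
      c * (j.N : ℝ) ^ (-ε) ≤ symmSqLOne j.f)
    (P : EllipticNewformIndex → EllipticNewformIndex → ℂ → ℂ)
    (hPd : ∀ i j, ¬ CM i → ¬ CM j → ¬ TwistEquiv i j → DifferentiableOn ℂ (P i j) (ball (2 : ℂ) (3 / 2)))
    {B₂ κ₂ : ℝ} (hB₂ : 0 ≤ B₂) (hκ₂ : 0 ≤ κ₂)
    (hPle : ∀ i j, ¬ CM i → ¬ CM j → ¬ TwistEquiv i j → ∀ s ∈ closedBall (2 : ℂ) (3 / 2),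
      ‖P i j s‖ ≤ B₂ * ((i.N : ℝ) * j.N) ^ κ₂)
    (hcoeff₃ : ∀ i j, ¬ CM i → ¬ CM j → ¬ TwistEquiv i j → ∃ a : ℕ → ℂ, 0 ≤ a ∧ a 1 = 1 ∧
      (∀ s : ℂ, 1 < s.re → LSeriesSummable a s) ∧
      ∀ s : ℂ, 1 < s.re →
        riemannZeta₁ s * (symmSqL i.N i.f s * symmSqL j.N j.f s * P i j s) = (s - 1) * LSeries a s)
    (hP1 : ∀ δ : ℝ, 0 < δ → ∃ T : ℝ, ∀ i j, ¬ CM i → ¬ CM j → ¬ TwistEquiv i j →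
      ‖P i j 1‖ ≤ T * ((i.N : ℝ) * j.N) ^ δ) :
    murty_petersson_newform_lower_bound := by
  let ι := {i : EllipticNewformIndex // ¬ CM i}
  refine murty_petersson_newform_lower_bound_of_pairData_indexed (ι := ι) Subtype.val
    (fun i j ↦ TwistEquiv i.1 j.1) (fun i j ↦ P i.1 j.1)
    (fun i j hij ↦ hPd i.1 j.1 i.2 j.2 hij) hB₂ hκ₂
    (fun i j hij ↦ hPle i.1 j.1 i.2 j.2 hij) (fun i j hij ↦ hcoeff₃ i.1 j.1 i.2 j.2 hij)
    (fun δ hδ ↦ ?_) (fun δ hδ ↦ ?_) (fun ε hε ↦ ?_)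
  · obtain ⟨T, hT⟩ := hP1 δ hδ
    exact ⟨T, fun i j hij ↦ hT i.1 j.1 i.2 j.2 hij⟩
  · obtain ⟨D, hD, hDle⟩ := twistEquiv_equiv_case hδ
    exact ⟨D, hD, fun i j hij ↦ hDle i.1 j.1 hij⟩
  · obtain ⟨c, hc, hcle⟩ := hCM ε hε
    refine ⟨c, hc, fun j hj ↦ hcle j ?_⟩
    by_contra hnot
    exact hj ⟨⟨j, hnot⟩, rfl⟩

end PairReduction

end Literature.NumberTheory.EllipticCurves.ModularForms

end
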